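import Literature.Claims.NS.Kyritsis2021
import Literature.Analysis.FluidPDE.TaoFiniteEnergyLerayHopf
import HarnessLib

/-!
# Solo salvage for claim C03b `Kyritsis2021` (cell `ns-claims`, D-0090): the energy inequality
# (Step 2) kernel-discharged for positive viscosity

Claim skeleton: `Literature/Claims/NS/Kyritsis2021.lean` (typist `ns-claims-typist-3`, p459522; the
«pressures» argument K-II). Predicted adjudication (refuter-7 R-PREDICTION): first failing printed
inference = `Step_5` (eqs. (34)–(35)/(37), pp. 20–21), load-bearing `Step_6` (Prop 5.1 p. 19). This
file is the SALVAGE side (seat `ns-claims-salvage-p3`): the TRUE steps before the failing one.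

* `Step_2` — the energy inequality `E(t) ≤ E(s)`, `s ≤ t` (eqs. (8)–(13), pp. 9–10; the author cites
  Majda–Bertozzi Prop. 1.13 (1.80); original: Leray 1934, (3.4)/(5.2)) — is typed for ALL `ν ≥ 0`.
  For `ν > 0` it is kernel-discharged here, for solutions in the class of Props 3.1/3.2 on `[0,T)`
  (`energy_antitone_of_isLocalClassSolution`) and on `[0,∞)` (`energy_antitone_of_isGlobalClassSolution`),
  packaged as `step2_of_pos_viscosity : 0 < ν → <body of Step_2 at ν>`: a class solution has finite
  energy on every `[0,t]`, `t < T` (the `n = 0` clause of the BKM class), hence its time translates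
  are Leray–Hopf weak solutions (Tao 2013 Lemma 8.1, tree `isLerayHopfOn_translate_of_finiteEnergy`,
  unconditional), whose energy inequality from the restart time `s` gives `E(t) ≤ E(s)`. The Euler
  instance `ν = 0` of `Step_2` (energy CONSERVATION for smooth decaying Euler solutions,
  Majda–Bertozzi Prop. 1.12 (iii)) is classical but not re-derived here (the tree's energy identity
  for classical solutions, `IsClassicalNSSolutionOn.hasDerivWithinAt_kineticEnergy`, asks for uniform
  rapid decay, which the BKM class does not record), so `Step_2` itself is tabled «ν > 0: kernel;
  ν = 0: classical + cite».
* `Step_1` (Prop 3.2/3.10, local theory) — classical (Majda–Bertozzi Thm 3.4, Cor. 3.1–3.2; tree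
  `MajdaBertozzi2002_localExistenceH3_holds`); `Step_4` (Prop 4.1, bounded pressures ⇒ continuation) —
  in print as Seregin–Šverák 2002 (tree named fact `seregin_sverak_2002`, undischarged); both tabled
  in `claims/Kyritsis2021/SALVAGE.md`, not re-derived here.

Solo lane (`Theorems/SoloSalvage<Slug>.lean`, no item).

WHAT THIS IS NOT: not a claim about NS regularity or blow-up; not a claim about any author beyond the
typed locator.
-/

noncomputable section

-- The summit-side namespace repeats the summit name by design (D-0017 layout); tree precedent
-- `SoloSalvageRamm2024.lean`.
set_option linter.dupNamespace false

open MeasureTheory Set Filter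
open scoped RealInnerProductSpace ENNReal Topology ContDiff

namespace Summit.NavierStokesRegularity.NavierStokesRegularity.Theorems.Kyritsis2021Salvage

open Literature.Analysis.FluidPDE Literature.Claims.NS.Kyritsis2021

/-- Bookkeeping: the `n = 0` Sobolev quantity of the BKM class is the `L²` energy integrand. -/
private theorem lintegral_enorm_iteratedFDeriv_zero
    (f : EuclideanSpace ℝ (Fin 3) → EuclideanSpace ℝ (Fin 3)) :
    (∫⁻ x, ‖iteratedFDeriv ℝ 0 f x‖ₑ ^ 2) = ∫⁻ x, ‖f x‖ₑ ^ 2 := by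
  refine lintegral_congr fun x => ?_
  rw [← ofReal_norm, norm_iteratedFDeriv_zero, ofReal_norm]

/-- **A class solution has finite energy, uniformly on every `[0,t]`, `t < T`** (the `n = 0` clause
of `HasBoundedSobolevNormsOn`; Props 3.1–3.2, pp. 7–8: the solution lies in `L^∞_t H^k` for all
`k`). -/
theorem finiteEnergy_of_isLocalClassSolution {ν T : ℝ}
    {u : ℝ → EuclideanSpace ℝ (Fin 3) → EuclideanSpace ℝ (Fin 3)}
    {p : ℝ → EuclideanSpace ℝ (Fin 3) → ℝ} (hsol : IsLocalClassSolution ν T u p) {t : ℝ}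
    (ht : t < T) : ∃ A : ℝ≥0∞, A < ⊤ ∧ ∀ τ ∈ Icc 0 t, ∫⁻ x, ‖u τ x‖ₑ ^ 2 ≤ A := by
  obtain ⟨C, hC⟩ := hsol.2 t ht 0
  refine ⟨C, ENNReal.coe_lt_top, fun τ hτ => ?_⟩
  rw [← lintegral_enorm_iteratedFDeriv_zero]
  exact hC τ hτ

/-- From the real kinetic energies to the `ℝ≥0∞` energies of the skeleton (`energy u t = ½∫⁻‖u‖ₑ²`),
for `L²` slices. -/
theorem energy_le_energy_of_kineticEnergy_le
    {u : ℝ → EuclideanSpace ℝ (Fin 3) → EuclideanSpace ℝ (Fin 3)} {s t : ℝ}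
    (hs : MemLp (u s) 2 volume) (ht : MemLp (u t) 2 volume)
    (h : VectorCalculus.kineticEnergy (u t) ≤ VectorCalculus.kineticEnergy (u s)) :
    energy u t ≤ energy u s := by
  unfold energy
  have e1 : (∫⁻ x, ‖u t x‖ₑ ^ 2) = eEnergy (u t) := rfl
  have e2 : (∫⁻ x, ‖u s x‖ₑ ^ 2) = eEnergy (u s) := rfl
  rw [e1, e2, eEnergy_eq_ofReal _ ht, eEnergy_eq_ofReal _ hs]
  gcongr

/-- **The energy inequality for class solutions on `[0,T)`, `ν > 0`**: `E(t) ≤ E(s)` for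
`0 ≤ s ≤ t < T` (eq. (13), p. 10; Leray 1934). Proof: restart at `s` — the translate `u(· + s)` of
the classical solution restricted to `[0,t]` is a Leray–Hopf weak solution from `u(s)` (Tao 2013,
Lemma 8.1; tree `isLerayHopfOn_translate_of_finiteEnergy`), and its energy inequality at time
`t − s` is `E(t) + ν∫ₛᵗ‖∇u‖² ≤ E(s)`. -/
theorem energy_antitone_of_isLocalClassSolution {ν T : ℝ} (hν : 0 < ν)
    {u : ℝ → EuclideanSpace ℝ (Fin 3) → EuclideanSpace ℝ (Fin 3)}
    {p : ℝ → EuclideanSpace ℝ (Fin 3) → ℝ} (hsol : IsLocalClassSolution ν T u p)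
    {s t : ℝ} (hs : s ∈ Ico 0 T) (ht : t ∈ Ico 0 T) (hst : s ≤ t) :
    energy u t ≤ energy u s := by
  rcases hst.eq_or_lt with h | hlt
  · rw [h]
  -- restrict to the closed slab `[0, t]`
  have ht0 : 0 < t := hs.1.trans_lt hlt
  have hcl : IsClassicalNSSolutionOn (Icc 0 t) ν 0 u p :=
    hsol.1.mono (fun τ hτ => ⟨hτ.1, hτ.2.trans_lt ht.2⟩) (uniqueDiffOn_Icc ht0)
  have hfe := finiteEnergy_of_isLocalClassSolution hsol ht.2
  -- Leray–Hopf from the restart time `s`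
  obtain ⟨hLH, -⟩ := isLerayHopfOn_translate_of_finiteEnergy hcl hν hs.1 hlt hfe
  obtain ⟨G, -, hEI⟩ := hLH.energy_ineq_zero
  have hmem : ∀ τ ∈ Icc 0 t, MemLp (u τ) 2 volume := by
    intro τ hτ
    obtain ⟨A, hAt, hA⟩ := hfe
    exact memLp_two_of_lintegral_lt_top (hcl.contDiff_velocity hτ).continuous
      ((hA τ hτ).trans_lt hAt)
  have hτ : t - s ∈ Icc 0 (t - s) := ⟨by linarith, le_rfl⟩
  have hineq := hEI (t - s) hτ
  have hforce : (∫ τ in (0 : ℝ)..(t - s), ∫ x,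
      ⟪(0 : ℝ → EuclideanSpace ℝ (Fin 3) → EuclideanSpace ℝ (Fin 3)) τ x, u (τ + s) x⟫) = 0 := by
    simp
  rw [sub_add_cancel, hforce, add_zero] at hineq
  have hD : 0 ≤ ν * (∫⁻ τ in Ioo 0 (t - s), ∫⁻ x,
      ENNReal.ofReal (frobeniusNormSq (G τ x))).toReal :=
    mul_nonneg hν.le ENNReal.toReal_nonneg
  have hKE : VectorCalculus.kineticEnergy (u t) ≤ VectorCalculus.kineticEnergy (u s) := by
    linarith
  exact energy_le_energy_of_kineticEnergy_le (hmem s ⟨hs.1, hlt.le⟩) (hmem t ⟨ht0.le, le_rfl⟩) hKE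

/-- **The energy inequality for global class solutions, `ν > 0`**: `E(t) ≤ E(s)` for `0 ≤ s ≤ t`
(a global class solution restricts to a class solution on `[0, t+1)`). -/
theorem energy_antitone_of_isGlobalClassSolution {ν : ℝ} (hν : 0 < ν)
    {u : ℝ → EuclideanSpace ℝ (Fin 3) → EuclideanSpace ℝ (Fin 3)}
    {p : ℝ → EuclideanSpace ℝ (Fin 3) → ℝ} (hsol : IsGlobalClassSolution ν u p)
    {s t : ℝ} (hs : 0 ≤ s) (hst : s ≤ t) : energy u t ≤ energy u s := by
  have hloc : IsLocalClassSolution ν (t + 1) u p :=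
    ⟨hsol.1.mono (fun τ hτ => hτ.1) (uniqueDiffOn_Ico 0 (t + 1)), fun T'' _ => hsol.2 T''⟩
  exact energy_antitone_of_isLocalClassSolution hν hloc ⟨hs, by linarith⟩ ⟨hs.trans hst, by linarith⟩
    hst

/-- **`Step_2` at positive viscosity — kernel-discharged.** For every `ν > 0`, both clauses of the
typed `Step_2` (the energy inequality (13) for class solutions on `[0,T)` and on `[0,∞)`, pp. 9–10)
hold. (The `ν = 0` clause of `Step_2` — energy conservation for decaying smooth Euler solutions,
Majda–Bertozzi Prop. 1.12 (iii) — is classical and not re-derived here.) -/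
theorem step2_of_pos_viscosity {ν : ℝ} (hν : 0 < ν) :
    (∀ T : ℝ, 0 < T →
      ∀ (u : ℝ → EuclideanSpace ℝ (Fin 3) → EuclideanSpace ℝ (Fin 3))
        (p : ℝ → EuclideanSpace ℝ (Fin 3) → ℝ), IsLocalClassSolution ν T u p →
      ∀ s ∈ Ico 0 T, ∀ t ∈ Ico 0 T, s ≤ t → energy u t ≤ energy u s) ∧
    (∀ (u : ℝ → EuclideanSpace ℝ (Fin 3) → EuclideanSpace ℝ (Fin 3))
        (p : ℝ → EuclideanSpace ℝ (Fin 3) → ℝ), IsGlobalClassSolution ν u p →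
      ∀ s t : ℝ, 0 ≤ s → s ≤ t → energy u t ≤ energy u s) :=
  ⟨fun _ _ _ _ hsol _ hs _ ht hst => energy_antitone_of_isLocalClassSolution hν hsol hs ht hst,
    fun _ _ hsol _ _ hs hst => energy_antitone_of_isGlobalClassSolution hν hsol hs hst⟩

end Summit.NavierStokesRegularity.NavierStokesRegularity.Theorems.Kyritsis2021Salvage
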